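import Mathlib
import Summits.ValiantsHypothesis.ValiantsHypothesis.Theorems.FifoMatchingNNNotVPSupportFnCircuitLowerBound
import Literature.Computability.Complexity.CliqueApproximators
import HarnessLib

/-!
# Route FifoMatching — crux `NNNotVP` (stmt-ValiantsHypothesis-11615), line `division_split`:
# monotone projections WITH CONSTANTS over `{∧₂, ∨₂}`, and `circuitSizeOver` from pointwise bounds

Registered line `Cruxes/NNNotVP/Lines/division_split.lean`; objects `σ` / `NN` / `SuppFn` /
`freeVars` = the line's vocabulary (`Theorems/FifoMatchingNNNotVPDivisionSplitDefs.lean`).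

Circuit-side infrastructure for the REDUCTION PRINCIPLE of the companion
`…SupportFnCliqueProjection` (stub A ⟸ a clique-like monotone projection of nest-free
perfect-matching existence):

* `exists_monotoneCircuit_projection` — projections WITH CONSTANTS cost `≤ 2·|κ|` extra gates over
  `monotoneBasis = {∧₂, ∨₂}` (which has no constant gates): the constant-`1` / constant-`0` wires
  are fed by `⋁ᵥ uᵥ` / `⋀ᵥ uᵥ`, which ARE `1` / `0` off the two extreme inputs, where monotonicity
  and the two hypotheses (`C(π(1…1)) = 1`, `C(π(0…0)) = 0`) give the right answer anyway;
* `le_circuitSizeOver_of_forall` — a pointwise lower bound plus one witness circuit bound the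
  (junk-`0`) infimum `circuitSizeOver`; `exists_monotoneCircuit_nfpm` — the witness for nest-free
  perfect-matching existence on `[2n]` (`n ≥ 1`);
* `card_KEdge_le` — `|E(K_m)| ≤ m²`.

Honest framing: bookkeeping; stubs Z / A / B2, the crux `NNNotVP` and `VP ≠ VNP` stay OPEN
(NOT proved).  No definitions, no named facts.
-/

noncomputable section

-- Sub = Summit single-conjunct layout: the duplicated namespace component is mandated by the tree.
set_option linter.dupNamespace false

namespace Summit.ValiantsHypothesis.ValiantsHypothesis.Theorems.FifoMatching.NNNotVP.DivisionSplit

open MvPolynomial Literature.Computability.AlgebraicComplexity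
open Literature.Computability.Complexity
open Literature.Computability.Complexity.GateList
open scoped NNReal BigOperators Classical

/-! ### Monotone projections with constants over `{∧₂, ∨₂}` -/

/-- **Projection closure of `{∧₂, ∨₂}`-circuits, constants included.**  Let `C` be a circuit over
`monotoneBasis` on variables `ι` and `e : ι → κ ⊕ Bool` a projection (variable `i` becomes the
variable `k` if `e i = inl k`, the constant `b` if `e i = inr b`).  If the projected function is `1`
at `(1,…,1)` and `0` at `(0,…,0)`, then a circuit over `monotoneBasis` on `κ` with at most
`C.size + 2·|κ|` gates computes it (the constant wires are replaced by `⋁ᵥ uᵥ` and `⋀ᵥ uᵥ`).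
[cite: Vollmer1999, §1.2] -/
theorem exists_monotoneCircuit_projection {ι κ : Type*} [Fintype κ] (C : Circuit ι)
    (hC : C.IsOver monotoneBasis) (e : ι → κ ⊕ Bool)
    (htop : C.eval (fun i => Sum.elim (fun _ : κ => true) id (e i)) = true)
    (hbot : C.eval (fun i => Sum.elim (fun _ : κ => false) id (e i)) = false) :
    ∃ D : Circuit κ, D.IsOver monotoneBasis ∧ D.size ≤ C.size + 2 * Fintype.card κ ∧
      ∀ u : κ → Bool, D.eval u = C.eval (fun i => Sum.elim u id (e i)) := by
  -- `κ` is nonempty (else the two hypotheses contradict each other)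
  obtain ⟨k, hk⟩ : ∃ k, Fintype.card κ = k + 1 := by
    rcases Nat.eq_zero_or_pos (Fintype.card κ) with h | h
    · exfalso
      haveI : IsEmpty κ := Fintype.card_eq_zero_iff.1 h
      have heq : (fun i => Sum.elim (fun _ : κ => true) id (e i)) =
          fun i => Sum.elim (fun _ : κ => false) id (e i) := by
        funext i
        cases e i with
        | inl v => exact isEmptyElim v
        | inr b => rfl
      rw [heq, hbot] at htop
      exact Bool.false_ne_true htop
    · exact ⟨Fintype.card κ - 1, by omega⟩
  -- an enumeration of the variables and the two replacement wires `⋀ uᵥ`, `⋁ uᵥ`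
  let en : Fin (k + 1) → κ := fun i => (Fintype.equivFin κ).symm (Fin.cast hk.symm i)
  have hen : Function.Surjective en := by
    intro v
    refine ⟨Fin.cast hk (Fintype.equivFin κ v), ?_⟩
    simp [en]
  let zC : Circuit κ := Circuit.bigAnd k fun i => Circuit.input (en i)
  let oC : Circuit κ := Circuit.bigOr k fun i => Circuit.input (en i)
  have hzC : ∀ u, zC.eval u = decide (∀ v, u v = true) := by
    intro u
    rw [show zC.eval u = decide (∀ i, (Circuit.input (en i)).eval u = true) from
      Circuit.eval_bigAnd k _ u]
    simp only [Circuit.eval_input]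
    apply decide_eq_decide.2
    exact ⟨fun h v => by obtain ⟨i, rfl⟩ := hen v; exact h i, fun h i => h (en i)⟩
  have hoC : ∀ u, oC.eval u = decide (∃ v, u v = true) := by
    intro u
    rw [show oC.eval u = decide (∃ i, (Circuit.input (en i)).eval u = true) from
      Circuit.eval_bigOr k _ u]
    simp only [Circuit.eval_input]
    apply decide_eq_decide.2
    exact ⟨fun ⟨i, hi⟩ => ⟨en i, hi⟩, fun ⟨v, hv⟩ => by obtain ⟨i, rfl⟩ := hen v; exact ⟨i, hv⟩⟩
  -- stage 1: the substitution, constants replaced by the two chains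
  let S : (κ → Bool) → (κ ⊕ Bool) → Bool := fun u w =>
    Sum.elim u (fun b => if b then oC.eval u else zC.eval u) w
  have hstage1 : CktSize monotoneBasis S (0 + (k + k)) := by
    have hz : CktSize monotoneBasis (fun (u : κ → Bool) (_ : Unit) => zC.eval u) k := by
      have := cktSize_of_circuit zC
        (Circuit.isOver_bigAnd Circuit.and_two_mem_monotoneBasis k _ fun i => Circuit.isOver_input _ _)
      rwa [show zC.size = k from size_bigAnd_input k en] at this
    have ho : CktSize monotoneBasis (fun (u : κ → Bool) (_ : Unit) => oC.eval u) k := by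
      have := cktSize_of_circuit oC
        (Circuit.isOver_bigOr Circuit.or_two_mem_monotoneBasis k _ fun i => Circuit.isOver_input _ _)
      rwa [show oC.size = k from size_bigOr_input k en] at this
    refine (((CktSize.id monotoneBasis).pair (hz.pair ho)).outMap
      (Sum.map id (fun b : Bool => if b then Sum.inr () else Sum.inl ()))).congr ?_
    intro u w
    rcases w with v | b
    · rfl
    · cases b <;> rfl
  -- stage 2: the circuit `C` read through `e`
  have hstage2 : CktSize monotoneBasis
      (fun (y : κ ⊕ Bool → Bool) (_ : Unit) => C.eval (fun i => y (e i))) C.size :=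
    (cktSize_of_circuit C hC).rewire e
  obtain ⟨D, hDB, hDs, hDev⟩ := (hstage1.comp hstage2).toCircuit
  refine ⟨D, hDB, by omega, fun u => ?_⟩
  rw [hDev]
  show C.eval (fun i => S u (e i)) = C.eval (fun i => Sum.elim u id (e i))
  have hmono := Circuit.monotone_eval_of_isOver_monotoneBasis C hC
  by_cases hall : ∀ v, u v = true
  · -- all-ones input: every replaced wire is `1`, and the answer is `1` on both sides
    have hu : u = fun _ => true := funext hall
    have hS : (fun i => S u (e i)) = fun _ => true := by
      funext i
      show Sum.elim u (fun b => if b then oC.eval u else zC.eval u) (e i) = true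
      cases e i with
      | inl v => exact hall v
      | inr b =>
        obtain ⟨i₀⟩ : Nonempty (Fin (k + 1)) := ⟨0⟩
        cases b
        · simpa [hzC] using hall
        · simpa [hoC] using ⟨en i₀, hall _⟩
    rw [hS, hu]
    have h1 : C.eval (fun i => Sum.elim (fun _ : κ => true) id (e i)) ≤ C.eval (fun _ => true) :=
      hmono (fun i => le_top)
    rw [htop] at h1 ⊢
    revert h1
    cases C.eval (fun _ => true) <;> decide
  by_cases hnone : ∀ v, u v = false
  · -- all-zeros input: every replaced wire is `0`, and the answer is `0` on both sides
    have hu : u = fun _ => false := funext hnone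
    have hS : (fun i => S u (e i)) = fun _ => false := by
      funext i
      show Sum.elim u (fun b => if b then oC.eval u else zC.eval u) (e i) = false
      cases e i with
      | inl v => exact hnone v
      | inr b =>
        obtain ⟨i₀⟩ : Nonempty (Fin (k + 1)) := ⟨0⟩
        cases b
        · simpa [hzC] using ⟨en i₀, by simp [hnone]⟩
        · simpa [hoC] using hnone
    rw [hS, hu]
    have h1 : C.eval (fun _ => false) ≤ C.eval (fun i => Sum.elim (fun _ : κ => false) id (e i)) :=
      hmono (fun i => bot_le)
    rw [hbot] at h1 ⊢
    revert h1
    cases C.eval (fun _ => false) <;> decide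
  -- mixed input: the two chains ARE the constants
  push Not at hall hnone
  obtain ⟨v₁, hv₁⟩ := hnone
  obtain ⟨v₀, hv₀⟩ := hall
  have ho1 : oC.eval u = true := by
    rw [hoC]; exact decide_eq_true ⟨v₁, by simpa using hv₁⟩
  have hz0 : zC.eval u = false := by
    rw [hzC]; exact decide_eq_false fun h => by simp [h v₀] at hv₀
  congr 1
  funext i
  show Sum.elim u (fun b => if b then oC.eval u else zC.eval u) (e i) = Sum.elim u id (e i)
  cases e i with
  | inl v => rfl
  | inr b => cases b <;> simp [ho1, hz0]

/-! ### `circuitSizeOver` from a pointwise bound -/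

/-- A pointwise lower bound on all circuits over `B` computing `f`, together with ONE such circuit
(so that the infimum is not the junk value `0`), bounds `circuitSizeOver B f` from below.
[cite: Vollmer1999, Def. 1.7] -/
theorem le_circuitSizeOver_of_forall {ι : Type*} {B : Set GateFn} {f : (ι → Bool) → Bool} {L : ℕ}
    (hex : ∃ C : Circuit ι, C.IsOver B ∧ C.Computes f)
    (hall : ∀ C : Circuit ι, C.IsOver B → C.Computes f → L ≤ C.size) :
    L ≤ circuitSizeOver B f := by
  obtain ⟨C, hCB, hCf⟩ := hex
  have hne : {s | ∃ C : Circuit ι, C.IsOver B ∧ C.Computes f ∧ C.size = s}.Nonempty :=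
    ⟨C.size, C, hCB, hCf, rfl⟩
  obtain ⟨C', hB', hf', hs'⟩ := Nat.sInf_mem hne
  unfold circuitSizeOver
  rw [← hs']
  exact hall C' hB' hf'

/-- Nest-free perfect-matching existence on `[2n]`, `n ≥ 1`, IS computed by some `{∧₂, ∨₂}`-circuit
(the constants-free Boolean shadow of `NN_n` itself). [folklore] -/
theorem exists_monotoneCircuit_nfpm (n : ℕ) (hn : 1 ≤ n) :
    ∃ C : Circuit (σ n), C.IsOver monotoneBasis ∧
      C.Computes (fun x : σ n → Bool => decide (SuppFn (NN n) (Finset.univ.filter fun e => x e = true))) := by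
  obtain ⟨hU, hE⟩ := suppFn_NN_univ_and_empty n hn
  have h1 : eval (fun _ => (1 : ℝ≥0)) (NN n) ≠ 0 := by
    have h := (suppFn_iff_eval_ne_zero (NN n) Finset.univ).1 hU
    simpa using h
  have h0 : eval (fun _ => (0 : ℝ≥0)) (NN n) = 0 := by
    by_contra h
    apply hE
    rw [suppFn_iff_eval_ne_zero]
    simpa using h
  obtain ⟨C, hC1, -, hC3⟩ := exists_monotoneCircuit_eval_ne_zero_pure (NN n) h1 h0
  refine ⟨C, hC1, fun x => ?_⟩
  rw [hC3 x]
  apply decide_eq_decide.2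
  rw [suppFn_iff_eval_ne_zero]
  simp [Finset.mem_filter]

/-! ### Small bookkeeping -/

/-- `K_m` has at most `m²` edges (`m choose 2 ≤ m²`). [folklore] -/
theorem card_KEdge_le (m : ℕ) : Fintype.card (KEdge m) ≤ m ^ 2 := by
  have h := SimpleGraph.card_edgeFinset_top_eq_card_choose_two (V := Fin m)
  rw [SimpleGraph.edgeFinset_card, Fintype.card_fin] at h
  calc Fintype.card (KEdge m) = m.choose 2 := by convert h
    _ ≤ m ^ 2 := by
        rw [Nat.choose_two_right, sq]
        exact le_trans (Nat.div_le_self _ _) (Nat.mul_le_mul_left _ (Nat.sub_le _ _))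

end Summit.ValiantsHypothesis.ValiantsHypothesis.Theorems.FifoMatching.NNNotVP.DivisionSplit

end
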